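import Summits.KontsevichZagierPeriods.KontsevichZagierPeriods.Theorems.TerasomaMultiplicationMultiplicationAccessibleStubStripBridgeAux

/-!
# `MultiplicationAccessible` (stmt-KontsevichZagierPeriods-12305), line `shifted-family-prime-sieve`,
stub `stub_stripBridge`

The BRIDGE, first half, at `x = 1/n` (`n = m + 1`): from the shifted Gauss-multiplication family
`GM m (1/n) s` (hypothesis) the crux's box representation
`r = [(0,1)^m, ∏ᵢ zᵢ^{(i+1)/n − 1}(1 − zᵢ)^{s−1}]` is KZ-equivalent to the Beta box
`q = [(0,1)^m, n^{ns−1} ∏ⱼ zⱼ^{(j+1)s−1}(1 − zⱼ)^{s−1}]`.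

Chain of moves: with `x = 1/n` the last left exponent of `GM` vanishes, so GM's left box is
`r ⊗ β₁`, `β₁ = [(0,1), (1 − t)^{s−1}]`, which ONE Newton–Leibniz move strips to `s⁻¹ • r`
(`exists_prod_oneSubPow`, primitive `−(1 − t)^s/s`); GM's right box is the rotation
(`KZ.of_sub_of_reindex_mem_relations` along `finRotate`) of `(n^{ns} • d) ⊗ β₂`,
`β₂ = [(0,1), (1 − t)^{ns−1}]`, `d = [(0,1)^m, ∏ⱼ zⱼ^{(j+1)s−1}(1 − zⱼ)^{s−1}]`
(`exists_shiftedBetaBox`), stripped to `(ns)⁻¹ • n^{ns} • d`; rescaling the chain by `s`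
(`KZ.Equivalent.constMul`) and congruence (`KZ.of_sub_of_mem_relations_of_eqOn`) give
`r ∼ n^{ns−1} • d = q`.

References: Kontsevich–Zagier 2001 §1.2 (rules (1)–(3)); Andrews–Askey–Roy 1999 Thm 1.5.2 (Gauss
multiplication), Thm 1.1.4 (Beta integral).
-/

noncomputable section

open MeasureTheory Set
open Literature.NumberTheory.Transcendental
open Literature.NumberTheory.Transcendental.KZ

namespace Summit.KontsevichZagierPeriods.TerasomaMultiplication.MultiplicationAccessible

/-! ## Algebraic constants of the bridge -/

/-- `n^r` is algebraic for `n = m + 1` and rational `r` (integer powers and roots of an algebraic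
number; the argument of `isAlgebraic_rpow_ratCast`, FischlerRivoalCorollary1Reduction, inlined to
keep imports light). [folklore] -/
theorem isAlgebraic_natSucc_rpow (m : ℕ) (r : ℚ) : IsAlgebraic ℚ (((m:ℝ) + 1) ^ (r:ℝ)) := by
  -- adapted from Literature.NumberTheory.Transcendental.FischlerRivoalCorollary1Reduction
  have hα : IsAlgebraic ℚ ((m:ℝ) + 1) := by
    rw [show ((m:ℝ) + 1) = ((m + 1 : ℕ) : ℝ) by push_cast; ring]
    exact isAlgebraic_nat _
  have hpos : (0:ℝ) < (m:ℝ) + 1 := by positivity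
  have hden : 0 < r.den := r.den_pos
  refine IsAlgebraic.of_pow hden ?_
  rw [← Real.rpow_natCast, ← Real.rpow_mul hpos.le, show (r : ℝ) * (r.den : ℕ) = (r.num : ℤ) by
    rw [show ((r.den : ℕ) : ℝ) = ((r.den : ℚ) : ℝ) by push_cast; rfl,
      show ((r.num : ℤ) : ℝ) = ((r.num : ℚ) : ℝ) by push_cast; rfl, ← Rat.cast_mul,
      Rat.mul_den_eq_num], Real.rpow_intCast]
  rcases Int.natAbs_eq r.num with h | h <;> rw [h]
  · rw [zpow_natCast]; exact hα.pow _
  · rw [zpow_neg, zpow_natCast]; exact (hα.pow _).inv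

/-! ## The shifted Beta box -/

/-- The shifted Beta box `[(0,1)^m, ∏ⱼ zⱼ^{(j+1)s−1}(1 − zⱼ)^{s−1}]` of the bridge exists for
rational `s > 0`. [folklore] -/
theorem exists_shiftedBetaBox (m : ℕ) {s : ℚ} (hs : 0 < s) :
    ∃ d : IntegralRep m, d.domain = {x | ∀ j, x j ∈ Ioo (0:ℝ) 1} ∧
      d.integrand = fun z => ∏ j : Fin m,
        (z j) ^ ((((j:ℕ):ℝ) + 1) * (s:ℝ) - 1) * (1 - z j) ^ ((s:ℝ) - 1) := by
  obtain ⟨d, hdd, hdi⟩ := exists_betaBox (fun j : Fin m => (((j:ℕ):ℚ) + 1) * s) (fun _ => s)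
    (fun j => by positivity) (fun _ => hs)
  refine ⟨d, hdd, ?_⟩
  rw [hdi]
  funext z
  refine Finset.prod_congr rfl fun j _ => ?_
  push_cast
  ring_nf

/-! ## The bridge -/

/-- **The bridge, first half, at `x = 1/n`** (`n = m + 1`): from `GM m (1/n) s` (hypothesis) the
crux's box representation `r` is equivalent to the Beta box
`q = [(0,1)^m, n^{ns−1} ∏ⱼ zⱼ^{(j+1)s−1}(1 − zⱼ)^{s−1}]`. Chain: `s⁻¹•r ∼ r ⊗ β₁` (strip of
`∫₀¹(1−t)^{s−1}dt = 1/s`, one Newton–Leibniz move, `exists_prod_oneSubPow`) `∼` (GM) the right box,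
which is the rotation (`KZ.of_sub_of_reindex_mem_relations`, `finRotate`) of
`(n^{ns}•d) ⊗ β₂ ∼ (ns)⁻¹•n^{ns}•d` (second strip); then rescale by `s` (`KZ.Equivalent.constMul`)
and conclude by congruence (`KZ.of_sub_of_mem_relations_of_eqOn`).
[cite: KontsevichZagier2001, §1.2 rules (1)–(3)] -/
theorem stub_stripBridge :
    ∀ (m : ℕ) (s : ℚ), 1 ≤ m → 0 < s →
      (∀ (r r' : KZ.IntegralRep (m + 1)),
        r.domain = {z | ∀ i, z i ∈ Set.Ioo (0:ℝ) 1} →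
        Set.EqOn r.integrand (fun z => ∏ k : Fin (m + 1),
          (z k) ^ ((((1 / ((m:ℚ) + 1) : ℚ)):ℝ) + ((k:ℕ):ℝ) / ((m:ℝ) + 1) - 1) *
            (1 - z k) ^ ((s:ℝ) - 1)) r.domain →
        r'.domain = {z | ∀ i, z i ∈ Set.Ioo (0:ℝ) 1} →
        Set.EqOn r'.integrand (fun z => ((m:ℝ) + 1) ^ (((m:ℝ) + 1) * (s:ℝ)) *
          ((z 0) ^ (((m:ℝ) + 1) * (((1 / ((m:ℚ) + 1) : ℚ)):ℝ) - 1) *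
            (1 - z 0) ^ (((m:ℝ) + 1) * (s:ℝ) - 1)) *
          ∏ j : Fin m, (z j.succ) ^ ((((j:ℕ):ℝ) + 1) * (s:ℝ) - 1) * (1 - z j.succ) ^ ((s:ℝ) - 1))
          r'.domain →
        KZ.Equivalent r r') →
      ∀ (r : KZ.IntegralRep m), r.domain = {z | ∀ i, z i ∈ Set.Ioo (0:ℝ) 1} →
        Set.EqOn r.integrand (fun z => ∏ i : Fin m,
          (z i) ^ ((((i:ℕ):ℝ) + 1) / ((m:ℝ) + 1) - 1) * (1 - z i) ^ ((s:ℝ) - 1)) r.domain →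
        ∃ q : KZ.IntegralRep m, q.domain = {z | ∀ i, z i ∈ Set.Ioo (0:ℝ) 1} ∧
          Set.EqOn q.integrand (fun z => ((m:ℝ) + 1) ^ (((m:ℝ) + 1) * (s:ℝ) - 1) *
            ∏ j : Fin m, (z j) ^ ((((j:ℕ):ℝ) + 1) * (s:ℝ) - 1) * (1 - z j) ^ ((s:ℝ) - 1))
            q.domain ∧
          KZ.Equivalent r q := by
  intro m s _hm hs hGM r hr hri
  have hsR : (0:ℝ) < s := by exact_mod_cast hs
  have hs0 : (s:ℝ) ≠ 0 := hsR.ne'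
  have hN : (0:ℝ) < (m:ℝ) + 1 := by positivity
  have hNs : (0:ℚ) < ((m:ℚ) + 1) * s := by positivity
  have hx : ((((1 / ((m:ℚ) + 1) : ℚ)) : ℝ)) = 1 / ((m:ℝ) + 1) := by push_cast; ring
  -- the algebraic constants
  have halg₁ : IsAlgebraic ℚ ((s:ℝ)⁻¹) := by
    simpa using isAlgebraic_algebraMap (R := ℚ) (A := ℝ) s⁻¹
  have halg₂ : IsAlgebraic ℚ (((m:ℝ) + 1) ^ (((m:ℝ) + 1) * (s:ℝ))) := by
    have h := isAlgebraic_natSucc_rpow m (((m:ℚ) + 1) * s)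
    push_cast at h
    exact h
  have halg₃ : IsAlgebraic ℚ ((((m:ℝ) + 1) * (s:ℝ))⁻¹) := by
    simpa using isAlgebraic_algebraMap (R := ℚ) (A := ℝ) ((((m:ℚ) + 1) * s)⁻¹)
  have halg₄ : IsAlgebraic ℚ (((m:ℝ) + 1) ^ (((m:ℝ) + 1) * (s:ℝ) - 1)) := by
    have h := isAlgebraic_natSucc_rpow m (((m:ℚ) + 1) * s - 1)
    push_cast at h
    exact h
  have halgs : IsAlgebraic ℚ (s:ℝ) := by
    simpa using isAlgebraic_algebraMap (R := ℚ) (A := ℝ) s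
  -- the Beta box `d`, the left strip `R = r ⊗ β₁`, the right strip `P = (n^{ns}•d) ⊗ β₂`
  obtain ⟨d, hdd, hdi⟩ := exists_shiftedBetaBox m hs
  obtain ⟨R, hRd, hRi, hR⟩ := exists_prod_oneSubPow r hs halg₁ rfl
  obtain ⟨P, hPd, hPi, hP⟩ := exists_prod_oneSubPow (d.constMul _ halg₂) hNs halg₃
    (by push_cast; ring)
  -- the data of `GM` : `R` is the left box, `P` rotated is the right box
  have hRdom : R.domain = {z | ∀ i, z i ∈ Set.Ioo (0:ℝ) 1} := by
    rw [hRd, hr]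
    ext z
    simp only [mem_setOf_eq, Fin.forall_fin_succ', Fin.init]
  have hRint : Set.EqOn R.integrand (fun z => ∏ k : Fin (m + 1),
      (z k) ^ ((((1 / ((m:ℚ) + 1) : ℚ)):ℝ) + ((k:ℕ):ℝ) / ((m:ℝ) + 1) - 1) *
        (1 - z k) ^ ((s:ℝ) - 1)) R.domain := by
    intro z hz
    rw [hRd] at hz
    obtain ⟨hz1, -⟩ := hz
    rw [hRi]
    simp only [hri hz1, Fin.prod_univ_castSucc, Fin.val_castSucc, Fin.val_last, hx]
    have h0 : 1 / ((m:ℝ) + 1) + (m:ℝ) / ((m:ℝ) + 1) - 1 = 0 := by field_simp; ring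
    rw [h0, Real.rpow_zero, one_mul]
    congr 1
    refine Finset.prod_congr rfl fun i _ => ?_
    rw [show (((i:ℕ):ℝ) + 1) / ((m:ℝ) + 1) - 1 = 1 / ((m:ℝ) + 1) + ((i:ℕ):ℝ) / ((m:ℝ) + 1) - 1 by
      ring]
    rfl
  have hR'dom : (P.reindex (finRotate (m + 1))).domain = {z | ∀ i, z i ∈ Set.Ioo (0:ℝ) 1} := by
    ext w
    simp only [IntegralRep.reindex_domain, hPd, IntegralRep.domain_constMul, hdd, mem_setOf_eq,
      Fin.init, finRotate_castSucc', finRotate_last, Fin.forall_fin_succ]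
    exact and_comm
  have hR'int : Set.EqOn (P.reindex (finRotate (m + 1))).integrand
      (fun z => ((m:ℝ) + 1) ^ (((m:ℝ) + 1) * (s:ℝ)) *
        ((z 0) ^ (((m:ℝ) + 1) * (((1 / ((m:ℚ) + 1) : ℚ)):ℝ) - 1) *
          (1 - z 0) ^ (((m:ℝ) + 1) * (s:ℝ) - 1)) *
        ∏ j : Fin m, (z j.succ) ^ ((((j:ℕ):ℝ) + 1) * (s:ℝ) - 1) * (1 - z j.succ) ^ ((s:ℝ) - 1))
      (P.reindex (finRotate (m + 1))).domain := by
    intro w _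
    simp only [IntegralRep.reindex_integrand, hPi, IntegralRep.integrand_constMul, hdi, Fin.init,
      finRotate_castSucc', finRotate_last, hx]
    have h0 : ((m:ℝ) + 1) * (1 / ((m:ℝ) + 1)) - 1 = 0 := by field_simp; ring
    rw [h0, Real.rpow_zero, one_mul]
    push_cast
    ring
  have hGM' : Equivalent R (P.reindex (finRotate (m + 1))) := hGM R _ hRdom hRint hR'dom hR'int
  have hPR' : Equivalent P (P.reindex (finRotate (m + 1))) := of_sub_of_reindex_mem_relations P _
  -- the chain `s⁻¹•r ∼ R ∼ R' ∼ P ∼ (ns)⁻¹•(n^{ns}•d)`, rescaled by `s`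
  have hchain : Equivalent (r.constMul _ halg₁) ((d.constMul _ halg₂).constMul _ halg₃) :=
    ((hR.symm.trans hGM').trans hPR'.symm).trans hP
  have hsc := Equivalent.constMul (s:ℝ) halgs hchain
  refine ⟨d.constMul _ halg₄, hdd, fun z _ => ?_, ?_⟩
  · simp only [IntegralRep.integrand_constMul, hdi]
  · refine (Equivalent.trans ?_ hsc).trans ?_
    · refine of_sub_of_mem_relations_of_eqOn rfl fun z _ => ?_
      simp only [IntegralRep.integrand_constMul]
      rw [← mul_assoc, mul_inv_cancel₀ hs0, one_mul]
    · refine of_sub_of_mem_relations_of_eqOn rfl fun z _ => ?_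
      simp only [IntegralRep.integrand_constMul]
      rw [Real.rpow_sub_one hN.ne']
      field_simp

end Summit.KontsevichZagierPeriods.TerasomaMultiplication.MultiplicationAccessible
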